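import Summits.FinalStateConjecture.FinalStateConjecture.Theorems.StarvedNecksGapDecaySufficesStubAssemblyDefsV10

/-!
# Stub `stub_perHoleRegauge` (A, v10) of line `Sketch`, crux `GapDecaySuffices` — file 1: DEFINITIONS

The two RESIDUAL sub-statements of the per-hole re-gauge `…V10.PerHoleRegauge`
(`FlatFarCertified → SwitchOffInward → PerHoleRegaugeCore`), both stated in the REST FRAME of hole `i`
(rest coordinates `y = Λᵢ⁻¹(x − cᵢ)`, lab coordinates `x = labOf Λᵢ cᵢ y = Λᵢ y + cᵢ`; rest time `y⁰ = tᵢ`,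
Euclidean rest norm `‖y⃗‖ = E4.spatialNorm y`; collar scale `σ(t) = 2ρ'(γᵢ t + cᵢ⁰)`, `γᵢ = (Λᵢ∂₀)⁰`):

* `TransitionSwitchOff` — steps (1)+(2) of the intended proof: a parity datum `P` of `Λᵢ` and data
  `(τA, τB, rin, κ₁, T, h₁, Bm)` satisfying EVERY hypothesis of the v10 `SwitchOffInward` with `h₂ := 0`
  (the model-plus-gauge field is folded into `Bm = g_{Mᵢ,aᵢ} + (Ψg ∘ labOf)^* g − g_{Mᵢ,aᵢ}` near the target
  box, so no inner cut-off of the gap deviation is needed), together with the interface to step (3): the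
  floor `τ₁ ≤ τB`, the inner radius `rin ≥ R₀ + 2 + |aᵢ|`, `rin → ∞`, `Bm = Kerr + restDev` on
  `{τB < y⁰, ‖y⃗‖ < 5σ/2}`, and the FACTORISATION `Ψg (labOf (T x)) = Φ (labOf (Q x))` on the collar `𝒞`
  (`T` is the rest-frame transition `Ψg⁻¹ ∘ Φ` of the `P`-relabelled label, `Q = P.Q`).
* `GluedChartCert` — step (3): from the OUTPUT of `SwitchOffInward` (a switched-off map `S` on the work
  box `𝒵`, `= id` inside `rin`, factorised through `Φ ∘ labOf ∘ Q` on the outer band, located, with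
  `C²`-small `S^* Bm − Bm`) plus `FlatFarCertified`, the single-hole certificate `SingleHoleCert` of the
  `P`-relabelled hole (glued chart `Ψa := Ψg ∘ labOf ∘ S ∘ Q ∘ Λᵢ⁻¹(· − cᵢ)` inside `13σ/8`, `:= Φ` beyond).

The reduction `perHoleRegauge_of : TransitionSwitchOff → GluedChartCert → V10.PerHoleRegauge` is file 2
(`…StubPerHoleRegaugeReduction.lean`).  Statement bundles only; no `sorry`, standard axioms.
-/

noncomputable section

open scoped Manifold ContDiff Topology ENNReal
open Filter Set Topology Literature.Geometry.Lorentzian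

namespace Summit.FinalStateConjecture.FinalStateConjecture.Theorems.GapDecaySuffices.PerHole

-- justified lint debt: the problem namespace repeats the summit name (`FinalStateConjecture.FinalStateConjecture`)
set_option linter.dupNamespace false

open Location.AnchoredV2 (HonestCore HonestFar DistinctVelocities)
open Relabel (ParityDatum relabelMotion)
open Assembly (FlatFarCertified pullbackMinus GapCert Located AdmissibleProfile SingleHoleCert)

/-- Lab coordinates `Λ y + c` of the rest-frame point `y` of the motion `(Λ, c)` (the inverse of
`poincareInv Λ c`). -/
def labOf (Λ : lorentzGroup) (c : E4) (y : E4) : E4 := (Λ : E4 ≃L[ℝ] E4) y + c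

/-- **Rest-frame deviation** of a chart `Ψ` of hole `i`'s background: the coordinate pullback along
`labOf Λᵢ cᵢ` of the zero-extended lab deviation `Ψ^* g − g_{Bᵢ}`; on the rest-frame image of the tube where
`Ψ` is smooth it is `(Ψ ∘ labOf)^* g − g_{Mᵢ,aᵢ}` (Kerr–Schild form of the hole AT REST). -/
def restDev {𝓢 : Spacetime.{0} 4} {O : Set 𝓢.carrier} (d : FinalStateDecomposition 𝓢 O 4) (i : Fin d.N)
    (Ψ : (d.background i).domain → 𝓢.carrier) : E4 → E4 →L[ℝ] E4 →L[ℝ] ℝ :=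
  bilinPullback (labOf (d.motion i).1 (d.motion i).2) (𝓢.deviationExtend (d.background i) Ψ)

/-- **Residual (A1) `TransitionSwitchOff`** — steps (1)+(2) of the per-hole re-gauge.  In the setting of
`PerHoleRegaugeCore` (honest `C⁴` decomposition, hole `i`, admissible profile `ρ'`, gap certificate above
`3·(16ρ') + 2`, located flat collar `[1.1ρ', 46ρ']`) there are a parity datum `P` of `Λᵢ` and rest-frame data
`(τA, τB, rin, κ₁, T, h₁, Bm)` such that, with `σ(t) = 2ρ'(γᵢ t + cᵢ⁰)`, collar
`𝒞 = {τA < x⁰, 3σ/4 < ‖x⃗‖ < 7σ/4}` and target box `𝒯 = {τB < y⁰, ‖y⃗‖ < 2σ}`: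
(interface) `τ₁ ≤ τB`, `R₀ + 2 + |aᵢ| ≤ rin`, `rin → ∞`, `Bm = g_{Mᵢ,aᵢ} + restDev` on `{τB < y⁰, ‖y⃗‖ < 5σ/2}`,
and the factorisation `Ψg (labOf (T x)) = Φ (labOf (Q x))` on `𝒞`; (S3 feed, `h₂ := 0`) `τB ≤ τA`, `rin`, `σ`
smooth with `|rin'|, |σ'| ≤ 1 ≤ rin ≤ σ`, `σ/rin → ∞`, `κ₁ → 0`, `Bm` smooth on `{τB < y⁰, rin/2 < ‖y⃗‖}`, `T`
smooth injective `𝒞 → 𝒯` with `det DT > 0`, `(DT∂₀)⁰ > 0`, located by `κ₁σ`, the EXACT isometry identity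
`Bm(Tx)(DT·, DT·) = η + h₁(x)` on `𝒞`, `h₁ → 0` in `C²` on the `𝒞`-slabs and `Bm − η → 0` in `C²` on the
`𝒯`-slabs beyond `rin/2`. -/
def TransitionSwitchOff : Prop :=
  ∀ (𝓢 : Spacetime.{0} 4) (O : Set 𝓢.carrier) (d : FinalStateDecomposition 𝓢 O 4) (R₀ : ℝ) (i : Fin d.N)
    (ρ' : ℝ → ℝ) (τm R₁ τ₁ τ₂ : ℝ) (W κ : ℝ → ℝ) (Ψg : (d.background i).domain → 𝓢.carrier),
    HonestCore 𝓢 O 4 d R₀ → HonestFar 𝓢 O 4 d R₀ → DistinctVelocities 𝓢 O 4 d →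
    AdmissibleProfile d R₀ i ρ' τm →
    GapCert d R₀ i (fun s ↦ 3 * (16 * ρ' s) + 2) R₁ τ₁ W Ψg →
    τ₁ ≤ τ₂ → Tendsto κ atTop (𝓝 0) → Located d i ρ' τ₁ W Ψg τ₂ κ (11 / 10) 46 →
    ∃ (P : ParityDatum (d.motion i).1) (τA τB : ℝ) (rin κ₁ : ℝ → ℝ) (T : E4 → E4)
      (h₁ Bm : E4 → E4 →L[ℝ] E4 →L[ℝ] ℝ),
      let Λ : lorentzGroup := (d.motion i).1
      let c : E4 := (d.motion i).2
      let γ : ℝ := (Λ : E4 ≃L[ℝ] E4) (E4.basisVector 0) 0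
      let σ : ℝ → ℝ := fun t ↦ 2 * ρ' (γ * t + c 0)
      let 𝒞 : Set E4 :=
        {x | τA < x 0 ∧ 3 / 4 * σ (x 0) < E4.spatialNorm x ∧ E4.spatialNorm x < 7 / 4 * σ (x 0)}
      let 𝒯 : Set E4 := {y | τB < y 0 ∧ E4.spatialNorm y < 2 * σ (y 0)}
      (τ₁ ≤ τB ∧ (∀ t, R₀ + 2 + |d.spin i| ≤ rin t) ∧ Tendsto rin atTop atTop ∧
        EqOn Bm (fun y ↦ Kerr.bilin (d.mass i) (d.spin i) y + restDev d i Ψg y)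
          {y | τB < y 0 ∧ E4.spatialNorm y < 5 / 2 * σ (y 0)} ∧
        (∀ x ∈ 𝒞, ∃ (hT : labOf Λ c (T x) ∈ (d.background i).domain)
          (hQ : labOf Λ c ((P.Q : E4 ≃L[ℝ] E4) x) ∈ d.flatDomain),
          Ψg ⟨labOf Λ c (T x), hT⟩ = d.flatChart ⟨labOf Λ c ((P.Q : E4 ≃L[ℝ] E4) x), hQ⟩)) ∧
      τB ≤ τA ∧ ContDiff ℝ ∞ rin ∧ ContDiff ℝ ∞ σ ∧
      (∀ τ, |deriv rin τ| ≤ 1 ∧ |deriv σ τ| ≤ 1 ∧ 1 ≤ rin τ ∧ rin τ ≤ σ τ) ∧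
      Tendsto (fun τ ↦ σ τ / rin τ) atTop atTop ∧ Tendsto κ₁ atTop (𝓝 0) ∧
      ContDiffOn ℝ ∞ (fun p : E4 × E4 ↦ Bm p.1 p.2)
        ({y | τB < y 0 ∧ rin (y 0) / 2 < E4.spatialNorm y} ×ˢ univ) ∧
      ContDiffOn ℝ ∞ T 𝒞 ∧ InjOn T 𝒞 ∧ MapsTo T 𝒞 𝒯 ∧
      (∀ x ∈ 𝒞, 0 < LinearMap.det (fderiv ℝ T x : E4 →ₗ[ℝ] E4) ∧ 0 < fderiv ℝ T x (E4.basisVector 0) 0) ∧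
      (∀ x ∈ 𝒞, |E4.spatialNorm (T x) - E4.spatialNorm x| ≤ κ₁ (x 0) * σ (x 0) ∧
        |T x 0 - x 0| ≤ κ₁ (x 0) * σ (x 0)) ∧
      (∀ x ∈ 𝒞, ∀ v w : E4,
        Bm (T x) (fderiv ℝ T x v) (fderiv ℝ T x w) = (Minkowski.bilin + h₁ x) v w) ∧
      Tendsto (fun τ ↦ supCkENorm {x | x ∈ 𝒞 ∧ x 0 = τ} 2 h₁) atTop (𝓝 0) ∧
      Tendsto (fun τ ↦ supCkENorm {y | y ∈ 𝒯 ∧ y 0 = τ ∧ rin τ / 2 ≤ E4.spatialNorm y} 2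
        (fun y ↦ Bm y - Minkowski.bilin)) atTop (𝓝 0)

/-- **Residual (A2) `GluedChartCert`** — step (3) of the per-hole re-gauge.  In the setting of
`PerHoleRegaugeCore` plus `FlatFarCertified`, for a parity datum `P` and the OUTPUT of the v10
`SwitchOffInward` fed as in `TransitionSwitchOff` — floors `τ₁ ≤ τB ≤ τA'`, inner radius
`R₀ + 2 + |aᵢ| ≤ rin ≤ σ`, `rin → ∞`, `κ' → 0`, `Bm = g_{Mᵢ,aᵢ} + restDev` on `{τB < y⁰, ‖y⃗‖ < 5σ/2}`, and a
map `S` smooth and injective on the work box `𝒵 = {τA' < x⁰, ‖x⃗‖ < 7σ/4}`, open, `𝒵 → 𝒯`, `= id` inside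
`rin`, FACTORISED `Ψg (labOf (S x)) = Φ (labOf (Q x))` on the outer band `‖x⃗‖ ≥ 3σ/2`, located by `κ'σ`, with
`S^* Bm − Bm → 0` in `C²` on the `𝒵`-slabs — there are `(τn, Rc, κ'', Ψa)` certifying the `P`-relabelled hole
(`SingleHoleCert`: K1'–K3', K3, K4, K6–K9, future lines, K11, inner location, coverage). -/
def GluedChartCert : Prop :=
  ∀ (𝓢 : Spacetime.{0} 4) (O : Set 𝓢.carrier) (d : FinalStateDecomposition 𝓢 O 4) (R₀ : ℝ) (i : Fin d.N)
    (ρ' : ℝ → ℝ) (τm R₁ τ₁ τ₂ : ℝ) (W κ : ℝ → ℝ) (Ψg : (d.background i).domain → 𝓢.carrier),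
    HonestCore 𝓢 O 4 d R₀ → HonestFar 𝓢 O 4 d R₀ → DistinctVelocities 𝓢 O 4 d →
    AdmissibleProfile d R₀ i ρ' τm →
    GapCert d R₀ i (fun s ↦ 3 * (16 * ρ' s) + 2) R₁ τ₁ W Ψg →
    τ₁ ≤ τ₂ → Tendsto κ atTop (𝓝 0) → Located d i ρ' τ₁ W Ψg τ₂ κ (11 / 10) 46 →
    FlatFarCertified →
    ∀ (P : ParityDatum (d.motion i).1) (τA' τB : ℝ) (rin κ' : ℝ → ℝ) (S : E4 → E4)
      (Bm : E4 → E4 →L[ℝ] E4 →L[ℝ] ℝ),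
      let Λ : lorentzGroup := (d.motion i).1
      let c : E4 := (d.motion i).2
      let γ : ℝ := (Λ : E4 ≃L[ℝ] E4) (E4.basisVector 0) 0
      let σ : ℝ → ℝ := fun t ↦ 2 * ρ' (γ * t + c 0)
      let 𝒵 : Set E4 := {x | τA' < x 0 ∧ E4.spatialNorm x < 7 / 4 * σ (x 0)}
      let 𝒯 : Set E4 := {y | τB < y 0 ∧ E4.spatialNorm y < 2 * σ (y 0)}
      τ₁ ≤ τB → τB ≤ τA' → (∀ t, R₀ + 2 + |d.spin i| ≤ rin t ∧ rin t ≤ σ t) →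
      Tendsto rin atTop atTop → Tendsto κ' atTop (𝓝 0) →
      EqOn Bm (fun y ↦ Kerr.bilin (d.mass i) (d.spin i) y + restDev d i Ψg y)
        {y | τB < y 0 ∧ E4.spatialNorm y < 5 / 2 * σ (y 0)} →
      ContDiffOn ℝ ∞ S 𝒵 → InjOn S 𝒵 → IsOpenMap (𝒵.restrict S) → MapsTo S 𝒵 𝒯 →
      (∀ x ∈ 𝒵, E4.spatialNorm x ≤ rin (x 0) → S x = x) →
      (∀ x ∈ 𝒵, 3 / 2 * σ (x 0) ≤ E4.spatialNorm x →
        ∃ (hS : labOf Λ c (S x) ∈ (d.background i).domain)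
          (hQ : labOf Λ c ((P.Q : E4 ≃L[ℝ] E4) x) ∈ d.flatDomain),
          Ψg ⟨labOf Λ c (S x), hS⟩ = d.flatChart ⟨labOf Λ c ((P.Q : E4 ≃L[ℝ] E4) x), hQ⟩) →
      (∀ x ∈ 𝒵, |E4.spatialNorm (S x) - E4.spatialNorm x| ≤ κ' (x 0) * σ (x 0) ∧
        |S x 0 - x 0| ≤ κ' (x 0) * σ (x 0)) →
      Tendsto (fun τ ↦ supCkENorm {x | x ∈ 𝒵 ∧ x 0 = τ} 2 (pullbackMinus Bm S Bm)) atTop (𝓝 0) →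
      ∃ (τn : ℝ) (Rc κ'' : ℝ → ℝ)
        (Ψa : (boostedKerrBackground (relabelMotion P) (d.motion i).2 (d.mass i) (d.spin i)).domain →
          𝓢.carrier),
        SingleHoleCert d R₀ i P ρ' τ₁ W Ψg τn Rc κ'' Ψa

end Summit.FinalStateConjecture.FinalStateConjecture.Theorems.GapDecaySuffices.PerHole

end
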